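import Mathlib.LinearAlgebra.FreeModule.PID
import Mathlib.LinearAlgebra.Matrix.Basis
import Mathlib.LinearAlgebra.Matrix.NonsingularInverse
import Mathlib.LinearAlgebra.Matrix.GeneralLinearGroup.Defs
import Mathlib.RingTheory.Localization.Integer
import Mathlib.RingTheory.Localization.FractionRing
import Mathlib.LinearAlgebra.Dimension.Finrank
import Mathlib.LinearAlgebra.FiniteDimensional.Basic
import Literature.NumberTheory.Automorphic.GLnAdelicStructure
import HarnessLib

/-!
# The Cartan decomposition of `GL_m` over a valued field; transpose-stability of double cosets

Trunk `AutomorphicAxiomatic` (G19), topic `NumberTheory/Automorphic`. Second layer (S2) of the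
branch turning the named fact `Flath1979_heckeOperatorAt_ofLocal_eq_smul` of
`UnramifiedHeckeScalars` (unramified local Hecke operators act by scalars on the `K(𝔫)`-fixed
vectors of a cuspidal automorphic representation of `GL_n`) into a theorem, itself part of the
decomposition of `Literature.NumberTheory.Automorphic.exists_cuspidal_baseChange_of_not_dvd` (**lang.S23**,
Arthur–Clozel, Ann. of Math. Stud. 120 (1989), Ch. 3, Thm. 4.2 (a)). The branch follows the
Gelfand-pair argument (Deitmar–Echterhoff (2014), Thm. 11.2.4; Bump (1997), Thm. 4.6.1 with
Prop. 4.6.2, and the proof of Thm. 3.3.3 for `GL(n)`; Getz–Hahn (2024), Thm. 5.5.1): the spherical Hecke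
operators of `(GL_m(K_v), GL_m(𝒪_v))` commute because transpose is an anti-involution fixing
every double coset, and then act by scalars on the `GL_m(𝒪_v)`-fixed vectors of an irreducible
unitary representation by Schur's lemma (`HilbertRepSchur`). This file supplies the input
**every double coset `GL_m(𝒪) x GL_m(𝒪)` contains a diagonal, hence symmetric, matrix**.

## Main results (all proved)

* `Literature.NumberTheory.Automorphic.Matrix.exists_eq_mul_diagonal_mul_of_mulVec_injective`: **Smith normal form** of a
  nonsingular square matrix `Y` over a principal ideal domain `R`: `Y = B · diagonal a · C`
  with `B`, `C` invertible over `R` — from Mathlib's Smith normal form of the full-rank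
  submodule `Y R^ι ≤ R^ι` (`Submodule.exists_smith_normal_form_of_rank_eq`; Jacobson,
  *Basic Algebra I*, §3.7; Bump (1997), Thm. 1.4.1, the elementary divisor theorem).
* `Literature.NumberTheory.Automorphic.Matrix.exists_map_mul_mul_map_eq_diagonal`: for `R` a PID with fraction field `F` and
  `x ∈ M_ι(F)` invertible, `k₁ x k₂` is diagonal for some `k₁, k₂` invertible over `R` (clear
  denominators with `IsLocalization.exist_integer_multiples_of_finite`, then Smith).
* `Literature.Automorphic.glTranspose m : GL m F ≃* (GL m F)ᵐᵒᵖ`, the transpose anti-automorphism,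
  with `glTranspose_mem_valuedCongruenceSubgroup` (the valued congruence subgroups
  `valuedCongruenceSubgroup m c` of `GLnAdelicStructure`, in particular `GL_m(𝒪) = ⋯ m 1`, are
  transpose-stable) and `map_mem_valuedCongruenceSubgroup_one` (`GL_m` of the valuation ring
  maps into `valuedCongruenceSubgroup m 1`).
* `Literature.NumberTheory.Automorphic.exists_valuedCongruenceSubgroup_mul_mul_eq_diagonal`: **Cartan
  decomposition** `GL_m(F) = GL_m(𝒪) D GL_m(𝒪)` for a valued field `F` whose valuation ring
  `𝒪 = {v ≤ 1}` is a PID (Bump (1997), Prop. 4.6.2 for `GL(2)`, proof of Thm. 3.3.3 for `GL(n)`), and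
  `exists_glTranspose_eq_mul_mul`: `xᵀ ∈ GL_m(𝒪) x GL_m(𝒪)` for every `x` (Bump (1997), proof
  of Thm. 4.6.1), with the specialisations `…_adicCompletion` to `F = K_v`, `𝒪 = 𝒪_v` for a
  number field `K` (Mathlib: `𝒪_v` is a discrete valuation ring, hence a PID).

## Design notes

* The anti-automorphism is packaged as a `MulEquiv` to the opposite group, so that
  `map_mul`/`map_inv` are available; `(glTranspose m g).unop` is the transposed element.
* Only existence of a diagonal representative is proved (no normalisation to powers of a
  uniformizer and no uniqueness), which is all Gelfand's trick needs.
* The valuation ring enters as Mathlib's `Valued.v.valuationSubring` (to which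
  `v.adicCompletionIntegers K` reduces by definition), with `IsFractionRing` from
  `ValuationSubring.instIsFractionRing`; the PID hypothesis is an instance argument, discharged
  for `K_v` by `isPrincipalIdealRing_valuationSubring_adicCompletion`.

## References

* D. Bump, *Automorphic Forms and Representations*, Cambridge Stud. Adv. Math. 55 (1997),
  Thm. 1.4.1, Prop. 4.6.2, Thm. 4.6.1, proof of Thm. 3.3.3 [Bump1997].
* J. R. Getz, H. Hahn, *An Introduction to Automorphic Representations* (2024), Thm. 5.5.1
  [GetzHahn2024].
* A. Deitmar, S. Echterhoff, *Principles of Harmonic Analysis* (2014), Thm. 11.2.4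
  [DeitmarEchterhoff2014].
-/

noncomputable section

open Matrix

namespace Literature.NumberTheory.Automorphic

/-! ### Smith normal form of a nonsingular square matrix over a PID -/

section PID

variable {R : Type*} [CommRing R] [IsDomain R] [IsPrincipalIdealRing R] {ι : Type*} [Fintype ι]
  [DecidableEq ι]

/-- **Smith normal form, nonsingular square case**: a square matrix `Y` over a principal ideal
domain whose columns are linearly independent (`Y.mulVec` injective) factors as
`Y = B * diagonal a * C` with `B`, `C` invertible over `R`. Derived from Mathlib's Smith normal
form for the submodule `Y R^ι ≤ R^ι` of full rank (`Submodule.exists_smith_normal_form_of_rank_eq`):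
`B` has the adapted basis of `R^ι` as columns and `C` is the change of basis of `Y R^ι` from
the columns of `Y` to the multiples `a i • b' i` (the elementary divisor theorem; Bump (1997),
Thm. 1.4.1 for `R = ℤ`; Jacobson, *Basic Algebra I*, §3.7). [cite: Bump1997, Thm. 1.4.1] -/
theorem Matrix.exists_eq_mul_diagonal_mul_of_mulVec_injective (Y : Matrix ι ι R)
    (hY : Function.Injective Y.mulVec) :
    ∃ (B C : Matrix ι ι R) (a : ι → R), IsUnit B ∧ IsUnit C ∧ Y = B * diagonal a * C := by
  classical
  set f : (ι → R) →ₗ[R] (ι → R) := Matrix.mulVecLin Y with hf_def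
  have hf : Function.Injective f := hY
  set N : Submodule R (ι → R) := LinearMap.range f with hN
  have hrank : Module.finrank R N = Module.finrank R (ι → R) :=
    LinearMap.finrank_range_of_inj hf
  obtain ⟨b', a, ab', hab'⟩ :=
    Submodule.exists_smith_normal_form_of_rank_eq (N := N) (Pi.basisFun R ι) hrank
  -- the basis of `N` given by the columns of `Y`
  let yb : Module.Basis ι R N := (Pi.basisFun R ι).map (LinearEquiv.ofInjective f hf)
  have hyb : ∀ j, ((yb j : N) : ι → R) = Y.col j := by
    intro j
    change ((LinearEquiv.ofInjective f hf (Pi.basisFun R ι j) : N) : ι → R) = _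
    rw [LinearEquiv.ofInjective_apply, Pi.basisFun_apply, hf_def, Matrix.mulVecLin_apply,
      Matrix.mulVec_single_one]
  let B : Matrix ι ι R := (Pi.basisFun R ι).toMatrix b'
  let C : Matrix ι ι R := ab'.toMatrix yb
  have hB : ∀ k i, B k i = b' i k := by
    intro k i
    simp [B, Module.Basis.toMatrix_apply]
  refine ⟨B, C, a, ?_, ?_, ?_⟩
  · letI := (Pi.basisFun R ι).invertibleToMatrix b'
    exact isUnit_of_invertible B
  · letI := ab'.invertibleToMatrix yb
    exact isUnit_of_invertible C
  · ext k j
    have h1 : Y k j = ((yb j : N) : ι → R) k := by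
      rw [hyb]
      rfl
    have h2 : ((yb j : N) : ι → R) = ∑ i, C i j • ((ab' i : N) : ι → R) := by
      have := ab'.sum_toMatrix_smul_self yb (j := j)
      rw [← this, Submodule.coe_sum]
      rfl
    rw [h1, h2, Finset.sum_apply, Matrix.mul_apply]
    refine Finset.sum_congr rfl fun i _ => ?_
    rw [Matrix.mul_diagonal, hab' i, Pi.smul_apply, Pi.smul_apply, smul_eq_mul, smul_eq_mul, hB]
    ring

end PID

/-! ### Diagonalisation over the fraction field by integral unimodular matrices -/

section Fraction

variable {R : Type*} [CommRing R] [IsDomain R] [IsPrincipalIdealRing R] {F : Type*} [Field F]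
  [Algebra R F] [IsFractionRing R F] {ι : Type*} [Fintype ι] [DecidableEq ι]

/-- **Elementary divisors over the fraction field** (the Cartan decomposition
`GL_n(F) = GL_n(R) · D · GL_n(R)` for a PID `R` with fraction field `F`, `D` the diagonal
matrices): for every invertible matrix `x` over `F` there are matrices `k₁`, `k₂` invertible
over `R` with `k₁ x k₂` diagonal. Proof: clear denominators (`s • x = Y` integral,
`IsLocalization.exist_integer_multiples_of_finite`), apply the Smith normal form
`Y = B · diagonal a · C` and take `k₁ = B⁻¹`, `k₂ = C⁻¹` (Jacobson, *Basic Algebra I*, §3.7;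
for `R = 𝒪_v`: Bump, *Automorphic Forms and Representations* (1997), Prop. 4.6.2 and proof of Thm. 3.3.3,
the p-adic Cartan decomposition via the elementary divisor theorem, Thm. 1.4.1).
[cite: Bump1997, Thm. 1.4.1 and Prop. 4.6.2] -/
theorem Matrix.exists_map_mul_mul_map_eq_diagonal (x : Matrix ι ι F) (hx : IsUnit x.det) :
    ∃ (k₁ k₂ : Matrix ι ι R) (d : ι → F), IsUnit k₁ ∧ IsUnit k₂ ∧
      k₁.map (algebraMap R F) * x * k₂.map (algebraMap R F) = diagonal d := by
  classical
  -- clear denominators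
  obtain ⟨s, hs⟩ := IsLocalization.exist_integer_multiples_of_finite (nonZeroDivisors R)
    (fun p : ι × ι => x p.1 p.2)
  choose y hy using hs
  set Y : Matrix ι ι R := Matrix.of fun i j => y (i, j) with hYdef
  have hsF : algebraMap R F s ≠ 0 := IsFractionRing.to_map_ne_zero_of_mem_nonZeroDivisors s.2
  have hYx : Y.map (algebraMap R F) = algebraMap R F s • x := by
    ext i j
    simp only [Matrix.map_apply, hYdef, Matrix.of_apply, hy, Matrix.smul_apply, smul_eq_mul,
      Algebra.smul_def]
  -- `Y` is nonsingular
  have hYinj : Function.Injective Y.mulVec := by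
    intro u w huw
    have h' : (Y.map (algebraMap R F)).mulVec (algebraMap R F ∘ u) =
        (Y.map (algebraMap R F)).mulVec (algebraMap R F ∘ w) := by
      ext i
      rw [← RingHom.map_mulVec, ← RingHom.map_mulVec, huw]
    have hunit : IsUnit (Y.map (algebraMap R F)) := by
      rw [hYx, Matrix.isUnit_iff_isUnit_det, Matrix.det_smul]
      exact (isUnit_iff_ne_zero.mpr (pow_ne_zero _ hsF)).mul hx
    have := Matrix.mulVec_injective_iff_isUnit.mpr hunit h'
    funext i
    exact IsFractionRing.injective R F (congrFun this i)
  obtain ⟨B, C, a, ⟨uB, rfl⟩, ⟨uC, rfl⟩, hYBC⟩ :=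
    Matrix.exists_eq_mul_diagonal_mul_of_mulVec_injective Y hYinj
  have hB' : ((uB⁻¹ : (Matrix ι ι R)ˣ) : Matrix ι ι R) * uB = 1 := uB.inv_mul
  have hC' : (uC : Matrix ι ι R) * ((uC⁻¹ : (Matrix ι ι R)ˣ) : Matrix ι ι R) = 1 := uC.mul_inv
  refine ⟨(uB⁻¹ : (Matrix ι ι R)ˣ), (uC⁻¹ : (Matrix ι ι R)ˣ),
    fun i => (algebraMap R F s)⁻¹ * algebraMap R F (a i), Units.isUnit _, Units.isUnit _, ?_⟩
  · have hx' : x = (algebraMap R F s)⁻¹ • Y.map (algebraMap R F) := by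
      rw [hYx, smul_smul, inv_mul_cancel₀ hsF, one_smul]
    rw [hx', Matrix.mul_smul, Matrix.smul_mul, ← Matrix.map_mul, ← Matrix.map_mul, hYBC,
      ← Matrix.mul_assoc, ← Matrix.mul_assoc, hB', Matrix.one_mul, Matrix.mul_assoc, hC',
      Matrix.mul_one, Matrix.diagonal_map (map_zero _), Matrix.smul_eq_diagonal_mul,
      Matrix.diagonal_mul_diagonal]

end Fraction

end Literature.NumberTheory.Automorphic

/-! ### The Cartan decomposition of `GL_m` of a valued field; transpose-stability of double cosets -/

namespace Literature.NumberTheory.Automorphic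

section Valued

variable {F Γ₀ : Type*} [Field F] [LinearOrderedCommGroupWithZero Γ₀] [Valued F Γ₀]
  (m : Type*) [Fintype m] [DecidableEq m]

/-- **Transpose** on `GL_m(F)` as an isomorphism onto the opposite group (an anti-automorphism):
`g ↦ gᵀ`, from Mathlib's `Matrix.transposeRingEquiv`. [folklore] -/
def glTranspose : GL m F ≃* (GL m F)ᵐᵒᵖ :=
  (Units.mapEquiv (Matrix.transposeRingEquiv m F).toMulEquiv).trans Units.opEquiv

variable {m}

/-- The underlying matrix of `glTranspose g` is `gᵀ`. [folklore] -/
@[simp]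
theorem coe_unop_glTranspose (g : GL m F) :
    (((glTranspose m g).unop : GL m F) : Matrix m m F) = (g : Matrix m m F)ᵀ := rfl

/-- `glTranspose` is an involution. [folklore] -/
@[simp]
theorem glTranspose_glTranspose (g : GL m F) :
    (glTranspose m ((glTranspose m g).unop)).unop = g :=
  Matrix.GeneralLinearGroup.ext fun _ _ => rfl

/-- The inverse of the transpose is the transpose of the inverse (in `GL_m`). [folklore] -/
theorem glTranspose_inv (g : GL m F) :
    (glTranspose m g⁻¹).unop = ((glTranspose m g).unop)⁻¹ := by
  rw [map_inv, MulOpposite.unop_inv]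

/-- The valued congruence subgroups are stable under transpose: the defining valuation bounds
are conditions on the sets of entries of `g`, `g⁻¹ = ((gᵀ)⁻¹)ᵀ` and `g - 1`. [folklore] -/
theorem glTranspose_mem_valuedCongruenceSubgroup {c : Γ₀} {g : GL m F}
    (hg : g ∈ valuedCongruenceSubgroup m c) :
    (glTranspose m g).unop ∈ valuedCongruenceSubgroup m c := by
  obtain ⟨h₁, h₂, h₃⟩ := hg
  refine ⟨fun i j => ?_, fun i j => ?_, fun i j => ?_⟩
  · rw [coe_unop_glTranspose, Matrix.transpose_apply]
    exact h₁ j i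
  · rw [← glTranspose_inv, coe_unop_glTranspose, Matrix.transpose_apply]
    exact h₂ j i
  · have : (((glTranspose m g).unop : GL m F) : Matrix m m F) - 1 = ((g : Matrix m m F) - 1)ᵀ := by
      rw [coe_unop_glTranspose, Matrix.transpose_sub, Matrix.transpose_one]
    rw [this, Matrix.transpose_apply]
    exact h₃ j i

/-- An invertible matrix over the valuation ring `𝒪 = {x | v x ≤ 1}` defines an element of
`GL_m(𝒪) = valuedCongruenceSubgroup m 1 ≤ GL_m(F)`. [folklore] -/
theorem map_mem_valuedCongruenceSubgroup_one
    (u : GL m (Valued.v (R := F)).valuationSubring) :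
    Matrix.GeneralLinearGroup.map (Valued.v (R := F)).valuationSubring.subtype u ∈
      valuedCongruenceSubgroup m (1 : Γ₀) := by
  have hint : ∀ (w : GL m (Valued.v (R := F)).valuationSubring) (i j : m),
      Valued.v ((Matrix.GeneralLinearGroup.map (Valued.v (R := F)).valuationSubring.subtype w :
        Matrix m m F) i j) ≤ 1 := by
    intro w i j
    exact ((w : Matrix m m (Valued.v (R := F)).valuationSubring) i j).2
  refine ⟨hint u, fun i j => ?_, fun i j => ?_⟩
  · rw [← map_inv]
    exact hint u⁻¹ i j
  · rw [Matrix.sub_apply]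
    refine (Valuation.map_sub _ _ _).trans (max_le (hint u i j) ?_)
    rw [Matrix.one_apply]
    split_ifs <;> simp

/-- **Cartan decomposition of `GL_m` over a valued field with principal valuation ring** (e.g. a
local field, or the completion `K_v` of a number field): every `x ∈ GL_m(F)` can be written
`k₁ x k₂ = d` with `k₁, k₂ ∈ GL_m(𝒪)` and `d` diagonal; equivalently every double coset
`GL_m(𝒪) x GL_m(𝒪)` contains a diagonal matrix (Bump, *Automorphic Forms and Representations*
(1997), Prop. 4.6.2 for `GL(2)`, proof of Thm. 3.3.3 for `GL(n)`). From
`Matrix.exists_map_mul_mul_map_eq_diagonal` (Smith normal form over the PID `𝒪`,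
`IsFractionRing 𝒪 F`). [cite: Bump1997, Prop. 4.6.2] -/
theorem exists_valuedCongruenceSubgroup_mul_mul_eq_diagonal
    [IsPrincipalIdealRing (Valued.v (R := F)).valuationSubring] (x : GL m F) :
    ∃ k₁ ∈ valuedCongruenceSubgroup m (1 : Γ₀), ∃ k₂ ∈ valuedCongruenceSubgroup m (1 : Γ₀),
      ∃ d : m → F, ((k₁ * x * k₂ : GL m F) : Matrix m m F) = Matrix.diagonal d := by
  set 𝒪 := (Valued.v (R := F)).valuationSubring with h𝒪
  obtain ⟨k₁, k₂, d, ⟨u₁, hu₁⟩, ⟨u₂, hu₂⟩, h⟩ :=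
    Literature.NumberTheory.Automorphic.Matrix.exists_map_mul_mul_map_eq_diagonal (R := 𝒪) (x : Matrix m m F)
      ((Matrix.isUnit_iff_isUnit_det _).mp (Units.isUnit x))
  refine ⟨Matrix.GeneralLinearGroup.map 𝒪.subtype u₁, map_mem_valuedCongruenceSubgroup_one u₁,
    Matrix.GeneralLinearGroup.map 𝒪.subtype u₂, map_mem_valuedCongruenceSubgroup_one u₂, d, ?_⟩
  rw [← h, ← hu₁, ← hu₂]
  rfl

/-- **Double cosets of `GL_m(𝒪)` are transpose-stable**: for every `x ∈ GL_m(F)` the transpose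
`xᵀ` lies in `GL_m(𝒪) x GL_m(𝒪)`. Indeed `k₁ x k₂ = d` diagonal gives
`(k₁ x k₂)ᵀ = k₁ x k₂`, i.e. `xᵀ = (k₂ᵀ)⁻¹ k₁ · x · k₂ (k₁ᵀ)⁻¹` with both outer factors in the
transpose-stable group `GL_m(𝒪)`. This is the input of Gelfand's trick for the commutativity of
the spherical Hecke algebra (Bump (1997), proof of Thm. 4.6.1: "these are invariant under
transpose"; Getz–Hahn (2024), Thm. 5.5.1). [cite: Bump1997, Thm. 4.6.1] -/
theorem exists_glTranspose_eq_mul_mul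
    [IsPrincipalIdealRing (Valued.v (R := F)).valuationSubring] (x : GL m F) :
    ∃ k₁ ∈ valuedCongruenceSubgroup m (1 : Γ₀), ∃ k₂ ∈ valuedCongruenceSubgroup m (1 : Γ₀),
      (glTranspose m x).unop = k₁ * x * k₂ := by
  obtain ⟨k₁, hk₁, k₂, hk₂, d, hd⟩ := exists_valuedCongruenceSubgroup_mul_mul_eq_diagonal x
  have hsymm : (glTranspose m (k₁ * x * k₂)).unop = k₁ * x * k₂ := by
    refine Matrix.GeneralLinearGroup.ext fun i j => ?_
    rw [coe_unop_glTranspose, hd, Matrix.diagonal_transpose]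
  have ht : (glTranspose m x).unop =
      ((glTranspose m k₂).unop)⁻¹ * (k₁ * x * k₂) * ((glTranspose m k₁).unop)⁻¹ := by
    conv_rhs => rw [← hsymm]
    rw [map_mul, map_mul, MulOpposite.unop_mul, MulOpposite.unop_mul]
    group
  refine ⟨((glTranspose m k₂).unop)⁻¹ * k₁, mul_mem (inv_mem ?_) hk₁,
    k₂ * ((glTranspose m k₁).unop)⁻¹, mul_mem hk₂ (inv_mem ?_), ?_⟩
  · exact glTranspose_mem_valuedCongruenceSubgroup hk₂
  · exact glTranspose_mem_valuedCongruenceSubgroup hk₁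
  · rw [ht]
    group

end Valued

/-! ### Specialisation to the completion `K_v` of a number field -/

section AdicCompletion

open NumberField IsDedekindDomain

variable {K : Type*} [Field K] [NumberField K] (v : HeightOneSpectrum (𝓞 K)) (m : Type*)
  [Fintype m] [DecidableEq m]

/-- The valuation ring of `K_v` is a principal ideal domain (it is `𝒪_v`, a discrete valuation
ring; Mathlib `IsPrincipalIdealRing (v.adicCompletionIntegers K)`). [folklore] -/
instance isPrincipalIdealRing_valuationSubring_adicCompletion :
    IsPrincipalIdealRing (Valued.v (R := v.adicCompletion K)).valuationSubring :=
  inferInstanceAs (IsPrincipalIdealRing (v.adicCompletionIntegers K))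

/-- **`p`-adic Cartan decomposition**: every double coset `GL_m(𝒪_v) x GL_m(𝒪_v)` in
`GL_m(K_v)` contains a diagonal matrix (Bump (1997), Prop. 4.6.2; proof of Thm. 3.3.3 for `GL(n)`). [cite: Bump1997, Prop. 4.6.2] -/
theorem exists_valuedCongruenceSubgroup_mul_mul_eq_diagonal_adicCompletion
    (x : GL m (v.adicCompletion K)) :
    ∃ k₁ ∈ valuedCongruenceSubgroup m (1 : WithZero (Multiplicative ℤ)),
      ∃ k₂ ∈ valuedCongruenceSubgroup m (1 : WithZero (Multiplicative ℤ)),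
        ∃ d : m → v.adicCompletion K,
          ((k₁ * x * k₂ : GL m (v.adicCompletion K)) : Matrix m m (v.adicCompletion K)) =
            Matrix.diagonal d :=
  exists_valuedCongruenceSubgroup_mul_mul_eq_diagonal x

/-- Double cosets of `GL_m(𝒪_v)` in `GL_m(K_v)` are transpose-stable (Bump (1997), proof of
Thm. 4.6.1). [cite: Bump1997, Thm. 4.6.1] -/
theorem exists_glTranspose_eq_mul_mul_adicCompletion (x : GL m (v.adicCompletion K)) :
    ∃ k₁ ∈ valuedCongruenceSubgroup m (1 : WithZero (Multiplicative ℤ)),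
      ∃ k₂ ∈ valuedCongruenceSubgroup m (1 : WithZero (Multiplicative ℤ)),
        (glTranspose m x).unop = k₁ * x * k₂ :=
  exists_glTranspose_eq_mul_mul x

end AdicCompletion

end Literature.NumberTheory.Automorphic
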